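import Mathlib
import Summits.ResolutionOfSingularities.ResolutionOfSingularities.Theorems.RadicialJungCleanModelsContactChainTracked
import Summits.ResolutionOfSingularities.ResolutionOfSingularities.Theorems.RadicialJungCleanModelsContactChainOfCleanRegAt
import Summits.ResolutionOfSingularities.ResolutionOfSingularities.Theorems.RadicialJungCleanModelsContactChainFamily
import HarnessLib

/-!
# Route `RadicialJung`, crux `CleanModels` (stmt-ResolutionOfSingularities-15917), line `Sketch` rev 35, stub 6 `stub_cleanProp44` (X44c),
# work plan O8 / L7b: the RESTART at an uncharged landing is governed by the starting point, and a good `p`-th-power approximation there exits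

Memo `Cruxes/CleanModels/Lines/Sketch-memo-hand2-g8-stubs-5-7.md` §2 (T1).  All-transversal presentation `u₀ · ∏_i (γ_i w^{k_i} + s₀ᵢ)^{a_i}` at `x₀`,
`p ∣ Σ k_i a_i = N' p`, `v := u₀ ∏ γ_i^{a_i}`.  At the landing `x_n` (`n ≥ max k_i`) the line reads `U · q^p` with `U ≡ σ^#(v) (mod 𝓘_{C_n,x_n})`
(✓ `contact_family_tracked_along_pointChain`).  If the residue of `v` is not a `p`-th power, ✓ `cleanPermissibleAt_of_pointChain_uncharged_of_residue`
exits.  Otherwise pick `c ∈ 𝒪_{X₀,x₀}`; if `v − c^p ∉ 𝓘_{C₀,x₀}` it has a contact normal form `v − c^p = γ₀ w^{k'} + s₀₀`, and: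

* `IsPointChainAlong.comp` — chains compose.
* `stalkMap_mem_of_pointChain` — `σ^#(𝓘_{C₀,x₀}) ⊆ 𝓘_{C_n,x_n}` along a chain.
* `uncharged_restart` — at `x_n` the line has the representative `Ω^{N'p} · R₁ · e^{N'p}` with `R₁ = (σ^#(γ₀) Ω^{k'}) · e^{k'} + s₁`, `s₁ ∈ 𝓘_{C_n,x_n}`:
  an all-transversal presentation AT `x_n` (coordinate `e`) with members `(R₁, exponent 1)` and `(e, exponent N'p)`, read off from `x₀`.
* `exists_pointChain_cleanPermissibleAt_of_goodApprox` — **exit from a GOOD approximation at `x₀`**: if `p ∤ k'`, or `p ∣ k'` and the residue of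
  `γ₀` is not a `p`-th power in `κ(x₀)`, then a dominant chain of `max k_i + k'` point blowing ups following the curve ends at a point where the
  line is clean-permissible for the strict transform.
What remains of (T1) after this: the EXISTENCE of a good approximation — by ✓ `Ccurve.dichotomy_of_best_approx` a BEST `p`-th-power approximation of
the restriction `v̄ ∈ 𝒪_{C₀,x₀}` is good, and best approximations exist in a defectless (e.g. excellent) discrete valuation ring as soon as `v̄` is not
a `p`-th power of `Frac 𝒪_{C₀,x₀}` (to be typed); the case `v̄ ∈ (Frac 𝒪_{C₀,x₀})^p` is the memo's (T2).

Honest framing: OURS (elementary); nothing here proves resolution in characteristic `p`, X44c, or any case of `CleanModels`.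
-/

noncomputable section

set_option linter.dupNamespace false -- mandated namespace of this single-conjunct summit

open CategoryTheory AlgebraicGeometry TopologicalSpace IsLocalRing
open Literature.AlgebraicGeometry.Resolution Literature.AlgebraicGeometry.Motives
open Scheme.IdealSheafData

universe u

namespace Summit.ResolutionOfSingularities.ResolutionOfSingularities.Theorems.RadicialJung.CleanModels

/-- **Chains of point blowing ups compose.** [folklore] -/
theorem IsPointChainAlong.comp {X₀ X₁ X₂ : Scheme.{u}} {σ₁ : X₁ ⟶ X₀} {C₀ : Closeds X₀} {C₁ : Closeds X₁} {x₁ : X₁} {n₁ : ℕ}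
    (h₁ : IsPointChainAlong σ₁ C₀ C₁ x₁ n₁) {σ₂ : X₂ ⟶ X₁} {C₂ : Closeds X₂} {x₂ : X₂} {n₂ : ℕ}
    (h₂ : IsPointChainAlong σ₂ C₁ C₂ x₂ n₂) (hx : σ₂ x₂ = x₁) : IsPointChainAlong (σ₂ ≫ σ₁) C₀ C₂ x₂ (n₁ + n₂) := by
  induction h₂ with
  | nil C₁ x₁' =>
    rw [Category.id_comp]
    have : x₁' = x₁ := hx
    subst this
    exact h₁
  | @cons X X' _ _ σ C₁ C n τ x' hx' hchain hYreg hτ hmem ih =>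
    have := ih h₁ hx
    rw [Category.assoc]
    exact IsPointChainAlong.cons (σ ≫ σ₁) C₀ C (n₁ + n) τ x' hx' this hYreg hτ hmem

/-- **The curve ideal is pushed into the curve ideal** along a chain of point blowing ups following the curve (`𝓘_C 𝒪' ⊆ e·𝓘_{C̃} ⊆ 𝓘_{C̃}` at
each step). [cite: CossartPiltant2008, Prop. 4.4 (proof, p. 10)] -/
theorem stalkMap_mem_of_pointChain {X₀ X : Scheme.{u}} {σ : X ⟶ X₀} {C₀ : Closeds X₀} {C : Closeds X} {x : X} {n : ℕ}
    (h : IsPointChainAlong σ C₀ C x n) [IsLocallyNoetherian X₀] [IsLocallyNoetherian X] (hX₀ : Scheme.IsRegular X₀)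
    (hC₀reg : ∀ y ∈ (C₀ : Set X₀), ∃ c : Fin 2 → X₀.presheaf.stalk y,
      IsRsopPart c ∧ Ideal.span (Set.range c) = stalkIdeal (vanishingIdeal C₀) y)
    (hxC₀ : σ x ∈ (C₀ : Set X₀)) (hdim₀ : ringKrullDim (X₀.presheaf.stalk (σ x)) = 3) :
    ∀ z ∈ stalkIdeal (vanishingIdeal C₀) (σ x), (σ.stalkMap x).hom z ∈ stalkIdeal (vanishingIdeal C) x := by
  induction h with
  | nil C₀ x₀ =>
    intro z hz
    rw [Scheme.Hom.stalkMap_id]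
    exact hz
  | @cons X X' _ _ σ C₀ C n τ x' hx hchain hYreg hτ hx' ih =>
    intro z hz
    obtain ⟨hX, hCreg, hxC, hdim⟩ := data_along_pointChain hchain hX₀ hC₀reg hxC₀ hdim₀
    obtain ⟨c2, hc2, hc2P⟩ := hCreg _ hxC
    -- a transversal coordinate at `τ x'` (any generator pair of the curve ideal plus a complement): use the tree's one-step lemma with the
    -- exceptional generator; `contact_drop_tracked` needs a transversal `w`, which we get from a regular system of parameters extending `c2`
    obtain ⟨e', he'0, he'gen⟩ := hτ.isEffectiveCartier.exists_stalkIdeal_eq_span x'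
    haveI : IsRegularLocalRing (X.presheaf.stalk (τ x')) := hX _
    obtain ⟨r, wv, hrank, hrsop, -⟩ := hc2.exists_rsop
    -- `wv` is a full regular system of parameters whose first two members are `c2`; its span is `𝔪`
    have hw : stalkIdeal (vanishingIdeal C) (τ x') ⊔ Ideal.span (Set.range wv) = maximalIdeal _ := by
      rw [hrsop]; exact sup_eq_right.mpr ((mem_support_iff_stalkIdeal_le _ _).mp
        (by rw [← SetLike.mem_coe, Scheme.IdealSheafData.coe_support_vanishingIdeal]; exact hxC))
    -- we only need `𝓘_C 𝒪' ⊆ e'·𝓘_{C̃}`, which is the second output of `contact_drop_tracked`; it does not depend on the choice of `w`,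
    -- but the lemma wants SOME `w` with `𝓘_C + (w) = 𝔪`; take `w := ` a suitable member: instead use the sum formulation via `Ideal.span`:
    -- simplest: pick `w` from `exists_contact_normalForm`-free route — we re-derive the inclusion directly as in `contact_drop_tracked`.
    have hPle : stalkIdeal (vanishingIdeal C) (τ x') ≤ maximalIdeal _ := le_sup_left.trans hw.le
    have htr : ∀ y ∈ (C : Set X) ∩ (⟨{τ x'}, hx⟩ : Closeds X),
        stalkIdeal (vanishingIdeal C) y ⊔ stalkIdeal (vanishingIdeal (⟨{τ x'}, hx⟩ : Closeds X)) y = maximalIdeal _ := by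
      rintro y ⟨-, hy⟩
      have hy' : y = τ x' := hy
      subst hy'
      rw [stalkIdeal_vanishingIdeal_singleton hx]
      exact sup_eq_right.mpr hPle
    have hdim' : ∀ y ∈ (C : Set X) ∩ (⟨{τ x'}, hx⟩ : Closeds X), ringKrullDim (X.presheaf.stalk y) = 3 := by
      rintro y ⟨-, hy⟩
      have hy' : y = τ x' := hy
      subst hy'
      exact hdim
    have hIeq : vanishingIdeal (⟨closure (τ ⁻¹' ((C : Set X) \ {τ x'})), isClosed_closure⟩ : Closeds X') =
        strictTransformIdeal τ (vanishingIdeal (⟨{τ x'}, hx⟩ : Closeds X)) (vanishingIdeal C) :=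
      (vanishingIdeal_closure_eq_strictTransformIdeal_of_transverse hτ hCreg htr hdim').1
    have hCY : vanishingIdeal C ≤ vanishingIdeal (⟨{τ x'}, hx⟩ : Closeds X) :=
      vanishingIdeal_antimono (fun z hz => by have hz' : z = τ x' := hz; subst hz'; exact hxC)
    have hle1 : (vanishingIdeal C).comap τ ≤ (vanishingIdeal (⟨{τ x'}, hx⟩ : Closeds X)).comap τ ^ 1 := by
      rw [pow_one]; exact comap_mono _ hCY
    have hprod := hτ.pow_mul_controlledTransform_eq hle1
    have hst : (vanishingIdeal C).comap τ ≤ vanishingIdeal (⟨closure (τ ⁻¹' ((C : Set X) \ {τ x'})), isClosed_closure⟩ : Closeds X') := by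
      rw [hIeq, ← hprod, pow_one]
      exact fun U => (Ideal.mul_mono_right (controlledTransform_le_strictTransformIdeal _ _ _ _ U)).trans Ideal.mul_le_left
    have hz' : ((τ ≫ σ).stalkMap x').hom z = (τ.stalkMap x').hom ((σ.stalkMap (τ x')).hom z) := by
      rw [Scheme.Hom.stalkMap_comp]; rfl
    rw [hz']
    have hmem : (τ.stalkMap x').hom ((σ.stalkMap (τ x')).hom z) ∈ (stalkIdeal (vanishingIdeal C) (τ x')).map (τ.stalkMap x').hom :=
      Ideal.mem_map_of_mem _ (ih hC₀reg hxC₀ hdim₀ z hz)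
    rw [← stalkIdeal_comap_eq_map_stalkMap] at hmem
    exact stalkIdeal_mono hst x' hmem

/-- The residue class of a non-`p`-th power survives a residually rational local map, up to unit `p`-th powers: if `v − c^p ∉ 𝔪₀` for every
`c`, `φ : 𝒪₀ → 𝒪` is a ring map of local rings, every element of `𝒪` is `φ(a)` modulo an ideal `P ⊆ 𝔪`, and `t` is a unit, then
`φ(v) t^p − c'^p ∉ 𝔪` for every `c'`. [folklore] -/
theorem not_mem_of_residue_not_pow {A B : Type u} [CommRing A] [IsLocalRing A] [CommRing B] [IsLocalRing B] (φ : A →+* B)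
    {P : Ideal B} (hP : P ≤ maximalIdeal B) (hsurj : ∀ y : B, ∃ a : A, y - φ a ∈ P) (p : ℕ) {v : A}
    (hv : ∀ c : A, v - c ^ p ∉ maximalIdeal A) {t : B} (ht : IsUnit t) (c' : B) : φ v * t ^ p - c' ^ p ∉ maximalIdeal B := by
  intro hc'
  obtain ⟨c, hc⟩ := hsurj (c' * ↑(ht.unit⁻¹))
  have htt : t * ↑(ht.unit⁻¹) = 1 := IsUnit.mul_val_inv ht
  -- `c' ≡ φ(c) t (mod 𝔪)`
  have h1 : c' - φ c * t ∈ maximalIdeal B := by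
    have : c' - φ c * t = (c' * ↑(ht.unit⁻¹) - φ c) * t := by
      have := htt; linear_combination (-(c' : B)) * this
    rw [this]
    exact Ideal.mul_mem_right _ _ (hP hc)
  have h2 : c' ^ p - (φ c * t) ^ p ∈ maximalIdeal B := by
    obtain ⟨r, hr⟩ := sub_dvd_pow_sub_pow c' (φ c * t) p
    rw [hr]; exact Ideal.mul_mem_right _ _ h1
  have h3 : φ (v - c ^ p) * t ^ p ∈ maximalIdeal B := by
    have : φ (v - c ^ p) * t ^ p = (φ v * t ^ p - c' ^ p) + (c' ^ p - (φ c * t) ^ p) := by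
      rw [map_sub, map_pow]; ring
    rw [this]; exact Ideal.add_mem _ hc' h2
  have h4 : φ (v - c ^ p) ∈ maximalIdeal B := by
    have : φ (v - c ^ p) = φ (v - c ^ p) * t ^ p * ↑((ht.pow p).unit⁻¹) := by
      rw [mul_assoc, IsUnit.mul_val_inv, mul_one]
    rw [this]; exact Ideal.mul_mem_right _ _ h3
  apply hv c
  by_contra hnot
  have hunit : IsUnit (v - c ^ p) := by by_contra hnu; exact hnot ((mem_maximalIdeal _).mpr hnu)
  exact (mem_maximalIdeal _).mp h4 (hunit.map φ)

/-- **The restart at an uncharged landing, read off from the starting point.**  See the module docstring.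
[cite: CossartJannsenSaito2020, proof of Thm. 6.28, Step 5] -/
theorem uncharged_restart {X₀ X : Scheme.{u}} [IsIntegral X₀] [IsIntegral X] {σ : X ⟶ X₀}
    [IsDominant σ] {C₀ : Closeds X₀} {C : Closeds X} {x : X} {n : ℕ} (h : IsPointChainAlong σ C₀ C x n)
    [IsLocallyNoetherian X₀] [IsLocallyNoetherian X] (hX₀ : Scheme.IsRegular X₀) (p : ℕ) [Fact p.Prime] [CharP X₀.functionField p]
    (hC₀reg : ∀ y ∈ (C₀ : Set X₀), ∃ c : Fin 2 → X₀.presheaf.stalk y,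
      IsRsopPart c ∧ Ideal.span (Set.range c) = stalkIdeal (vanishingIdeal C₀) y)
    (hxC₀ : σ x ∈ (C₀ : Set X₀)) (hdim₀ : ringKrullDim (X₀.presheaf.stalk (σ x)) = 3)
    (G : X₀.functionField) (cc : Fin p → X₀.functionField) (hcc : ∃ j : Fin p, (j : ℕ) ≠ 0 ∧ cc j ≠ 0)
    (w u₀ : X₀.presheaf.stalk (σ x)) (hw : stalkIdeal (vanishingIdeal C₀) (σ x) ⊔ Ideal.span {w} = maximalIdeal _)
    {m : ℕ} (γ s₀ : Fin m → X₀.presheaf.stalk (σ x))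
    (hs₀ : ∀ i, s₀ i ∈ stalkIdeal (vanishingIdeal C₀) (σ x)) (k a : Fin m → ℕ) (hkn : ∀ i, k i ≤ n)
    {N' : ℕ} (hN : ∑ i, k i * a i = N' * p)
    (hX : (∑ j : Fin p, cc j ^ p * G ^ (j : ℕ)) =
      RatFn.toFunctionField (σ x) (u₀ * ∏ i, (γ i * w ^ k i + s₀ i) ^ a i))
    (c γ₀ s₀₀ : X₀.presheaf.stalk (σ x)) (k' : ℕ) (hs₀₀ : s₀₀ ∈ stalkIdeal (vanishingIdeal C₀) (σ x))
    (hvc : u₀ * ∏ i, γ i ^ a i - c ^ p = γ₀ * w ^ k' + s₀₀) :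
    ∃ (e Ω : X.presheaf.stalk x) (s₁ : X.presheaf.stalk x) (cc' : Fin p → X.functionField),
      stalkIdeal (vanishingIdeal C) x ⊔ Ideal.span {e} = maximalIdeal _ ∧ IsUnit Ω ∧ (σ.stalkMap x).hom w = Ω * e ∧
      s₁ ∈ stalkIdeal (vanishingIdeal C) x ∧ (∃ j : Fin p, (j : ℕ) ≠ 0 ∧ cc' j ≠ 0) ∧
      (∀ y : X.presheaf.stalk x, ∃ a : X₀.presheaf.stalk (σ x), y - (σ.stalkMap x).hom a ∈ stalkIdeal (vanishingIdeal C) x) ∧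
      (∑ j : Fin p, cc' j ^ p * (RatFn.functionFieldMap σ G) ^ (j : ℕ)) =
        RatFn.toFunctionField x (Ω ^ (N' * p) *
          ∏ l : Fin 2, ((![(σ.stalkMap x).hom γ₀ * Ω ^ k', 1] : Fin 2 → _) l * e ^ (![k', 1] : Fin 2 → ℕ) l +
            (![s₁, 0] : Fin 2 → _) l) ^ (![1, N' * p] : Fin 2 → ℕ) l) := by
  classical
  obtain ⟨hXreg, hCreg, hxC, hdim, hsurj, e, Ω, he, hΩ, hwimg, hfam⟩ :=
    contact_family_tracked_along_pointChain h hX₀ hC₀reg hxC₀ hdim₀ w hw γ s₀ hs₀ k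
  have hPmap := stalkMap_mem_of_pointChain h hX₀ hC₀reg hxC₀ hdim₀
  haveI : IsRegularLocalRing (X.presheaf.stalk x) := hXreg x
  haveI : CharP X.functionField p := ((RatFn.functionFieldMap σ).charP_iff_charP p).mp inferInstance
  have hPle : stalkIdeal (vanishingIdeal C) x ≤ maximalIdeal _ := le_sup_left.trans he.le
  choose π' hπ' hsimg using hfam
  set φ := (σ.stalkMap x).hom with hφ
  have hsimg' : ∀ i, φ (γ i * w ^ k i + s₀ i) = (φ (γ i) * Ω ^ k i + π' i) * e ^ k i := by
    intro i
    rw [hφ, hsimg i, Nat.min_eq_right (hkn i), Nat.sub_eq_zero_of_le (hkn i), pow_zero, mul_one]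
    ring
  -- `U ≡ φ(v) (mod 𝓘_C)`: expand the product modulo the curve ideal
  set V : X.presheaf.stalk x := φ u₀ * ∏ i, (φ (γ i) * Ω ^ k i + π' i) ^ a i with hV
  have hVv : V - φ (u₀ * ∏ i, γ i ^ a i) * Ω ^ (N' * p) ∈ stalkIdeal (vanishingIdeal C) x := by
    rw [← Ideal.Quotient.eq_zero_iff_mem, map_sub, sub_eq_zero, hV]
    have hπ0 : ∀ i, Ideal.Quotient.mk (stalkIdeal (vanishingIdeal C) x) (π' i) = 0 := fun i =>
      Ideal.Quotient.eq_zero_iff_mem.mpr (hπ' i)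
    simp only [map_mul, map_prod, map_pow, map_add, hπ0, add_zero, mul_pow, ← pow_mul, Finset.prod_mul_distrib,
      Finset.prod_pow_eq_pow_sum, hN]
    ring
  -- the representative at `x`: `V · e^{N'p}`
  have himg : φ (u₀ * ∏ i, (γ i * w ^ k i + s₀ i) ^ a i) = V * e ^ (N' * p) := by
    rw [hV, map_mul, map_prod]
    simp only [map_pow, hsimg', mul_pow, ← pow_mul, Finset.prod_mul_distrib, Finset.prod_pow_eq_pow_sum, hN]
    ring
  have hX' : (∑ j : Fin p, (RatFn.functionFieldMap σ (cc j)) ^ p * (RatFn.functionFieldMap σ G) ^ (j : ℕ)) =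
      RatFn.toFunctionField x (V * e ^ (N' * p)) := by
    calc (∑ j : Fin p, (RatFn.functionFieldMap σ (cc j)) ^ p * (RatFn.functionFieldMap σ G) ^ (j : ℕ))
        = RatFn.functionFieldMap σ (∑ j : Fin p, cc j ^ p * G ^ (j : ℕ)) := by
          rw [map_sum]; simp only [map_mul, map_pow]
      _ = RatFn.functionFieldMap σ (RatFn.toFunctionField (σ x) (u₀ * ∏ i, (γ i * w ^ k i + s₀ i) ^ a i)) := by rw [hX]
      _ = RatFn.toFunctionField x ((σ.stalkMap x) (u₀ * ∏ i, (γ i * w ^ k i + s₀ i) ^ a i)) :=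
          RatFn.functionFieldMap_toFunctionField σ x _
      _ = RatFn.toFunctionField x (V * e ^ (N' * p)) := congrArg (RatFn.toFunctionField x) himg
  have hcc' : ∃ j : Fin p, (j : ℕ) ≠ 0 ∧ RatFn.functionFieldMap σ (cc j) ≠ 0 := by
    obtain ⟨j, hj, hj0⟩ := hcc
    exact ⟨j, hj, fun h0 => hj0 ((RatFn.functionFieldMap σ).injective (by rw [h0, map_zero]))⟩
  -- shift by the `p`-th power `(φ(c) · Ω^{N'} · e^{N'})^p`
  obtain ⟨cc', hcc'', hX''⟩ := rep_shift_sub_pow p (RatFn.toFunctionField x) (RatFn.functionFieldMap σ G) _ hcc'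
    (V * e ^ (N' * p)) (φ c * Ω ^ N' * e ^ N') hX'
  -- the new representative `R₁ · Ω^{N'p} e^{N'p}` with `R₁ = φ(γ₀) Ω^{k'} e^{k'} + s₁`
  set s₁ : X.presheaf.stalk x := (V - φ (u₀ * ∏ i, γ i ^ a i) * Ω ^ (N' * p)) * ↑((hΩ.pow (N' * p)).unit⁻¹) + φ s₀₀ with hs₁
  have hΩΩ : Ω ^ (N' * p) * ↑((hΩ.pow (N' * p)).unit⁻¹) = 1 := IsUnit.mul_val_inv _
  have hs₁P : s₁ ∈ stalkIdeal (vanishingIdeal C) x :=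
    Ideal.add_mem _ (Ideal.mul_mem_right _ _ hVv) (hPmap _ hs₀₀)
  refine ⟨e, Ω, s₁, cc', he, hΩ, hwimg, hs₁P, hcc'', hsurj, ?_⟩
  rw [hX'']
  congr 1
  simp only [Fin.prod_univ_two, Matrix.cons_val_zero, Matrix.cons_val_one, pow_one, one_mul, add_zero]
  -- `V e^{N'p} − (φc Ω^{N'} e^{N'})^p = Ω^{N'p} · (φγ₀ Ω^{k'} e^{k'} + s₁) · e^{N'p}`
  have hvc' : φ (u₀ * ∏ i, γ i ^ a i) = φ c ^ p + φ γ₀ * (Ω * e) ^ k' + φ s₀₀ := by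
    have h1 : u₀ * ∏ i, γ i ^ a i = c ^ p + (γ₀ * w ^ k' + s₀₀) := by rw [← hvc]; ring
    rw [h1, map_add, map_add, map_pow, map_mul, map_pow, hwimg]
    ring
  have hu : (↑((hΩ.pow (N' * p)).unit⁻¹) : X.presheaf.stalk x) * Ω ^ (N' * p) = 1 := by rw [mul_comm]; exact hΩΩ
  rw [hs₁]
  linear_combination (-(e ^ (N' * p) * (V - φ (u₀ * ∏ i, γ i ^ a i) * Ω ^ (N' * p)))) * hu +
    (Ω ^ (N' * p) * e ^ (N' * p)) * hvc'

/-- **Exit from a good `p`-th-power approximation at the starting point.**  See the module docstring.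
[cite: CossartJannsenSaito2020, proof of Thm. 6.28, Step 5] [cite: CossartPiltant2008, Prop. 4.4 (proof, p. 10)] -/
theorem exists_pointChain_cleanPermissibleAt_of_goodApprox {X₀ : Scheme.{u}} [IsIntegral X₀] [IsLocallyNoetherian X₀]
    (hX₀ : Scheme.IsRegular X₀) (p : ℕ) [Fact p.Prime] [CharP X₀.functionField p] {C₀ : Closeds X₀}
    (hC₀reg : ∀ y ∈ (C₀ : Set X₀), ∃ c : Fin 2 → X₀.presheaf.stalk y,
      IsRsopPart c ∧ Ideal.span (Set.range c) = stalkIdeal (vanishingIdeal C₀) y)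
    {x₀ : X₀} (hx₀ : IsClosed ({x₀} : Set X₀)) (hx₀C : x₀ ∈ (C₀ : Set X₀)) (hdim₀ : ringKrullDim (X₀.presheaf.stalk x₀) = 3)
    (G : X₀.functionField) (cc : Fin p → X₀.functionField) (hcc : ∃ j : Fin p, (j : ℕ) ≠ 0 ∧ cc j ≠ 0)
    (w u₀ : X₀.presheaf.stalk x₀) (hw : stalkIdeal (vanishingIdeal C₀) x₀ ⊔ Ideal.span {w} = maximalIdeal _)
    {m : ℕ} (γ s₀ : Fin m → X₀.presheaf.stalk x₀)
    (hs₀ : ∀ i, s₀ i ∈ stalkIdeal (vanishingIdeal C₀) x₀) (k a : Fin m → ℕ) {N' : ℕ} (hN : ∑ i, k i * a i = N' * p)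
    (hX : (∑ j : Fin p, cc j ^ p * G ^ (j : ℕ)) = RatFn.toFunctionField x₀ (u₀ * ∏ i, (γ i * w ^ k i + s₀ i) ^ a i))
    (c γ₀ s₀₀ : X₀.presheaf.stalk x₀) (k' : ℕ) (hk' : 1 ≤ k') (hγ₀ : IsUnit γ₀) (hs₀₀ : s₀₀ ∈ stalkIdeal (vanishingIdeal C₀) x₀)
    (hvc : u₀ * ∏ i, γ i ^ a i - c ^ p = γ₀ * w ^ k' + s₀₀)
    (hgood : ¬ p ∣ k' ∨ ∀ c₁ : X₀.presheaf.stalk x₀, γ₀ - c₁ ^ p ∉ maximalIdeal _) :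
    ∃ (X : Scheme.{u}) (_ : IsIntegral X) (_ : IsLocallyNoetherian X) (σ : X ⟶ X₀) (_ : IsDominant σ) (C : Closeds X) (x : X) (n : ℕ),
      IsPointChainAlong σ C₀ C x n ∧ σ x = x₀ ∧ IsClosed ({x} : Set X) ∧
      CleanPermissibleAt p (RatFn.toFunctionField x) (RatFn.functionFieldMap σ G) (stalkIdeal (vanishingIdeal C) x) := by
  classical
  -- chain 1: exhaust the transversal contacts
  obtain ⟨X₁, hX₁i, hX₁n, σ₁, hσ₁d, C₁, x₁, h₁, hσ₁x, hx₁cl⟩ :=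
    exists_pointChainAlong_isDominant hX₀ hC₀reg hx₀ hx₀C hdim₀ (Finset.univ.sup k)
  subst hσ₁x
  have hkn : ∀ i, k i ≤ Finset.univ.sup k := fun i => Finset.le_sup (Finset.mem_univ i)
  obtain ⟨e, Ω, s₁, cc', he, hΩ, hwimg, hs₁, hcc', hsurj, hX₁⟩ :=
    uncharged_restart h₁ hX₀ p hC₀reg hx₀C hdim₀ G cc hcc w u₀ hw γ s₀ hs₀ k a hkn hN hX c γ₀ s₀₀ k' hs₀₀ hvc
  obtain ⟨hX₁reg, hC₁reg, hx₁C, hdim₁⟩ := data_along_pointChain h₁ hX₀ hC₀reg hx₀C hdim₀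
  haveI : IsRegularLocalRing (X₁.presheaf.stalk x₁) := hX₁reg x₁
  haveI : CharP X₁.functionField p := ((RatFn.functionFieldMap σ₁).charP_iff_charP p).mp inferInstance
  -- chain 2: `k'` more point blowing ups from `x₁`
  obtain ⟨X₂, hX₂i, hX₂n, σ₂, hσ₂d, C₂, x₂, h₂, hσ₂x, hx₂cl⟩ :=
    exists_pointChainAlong_isDominant hX₁reg hC₁reg hx₁cl hx₁C hdim₁ k'
  subst hσ₂x
  refine ⟨X₂, hX₂i, hX₂n, σ₂ ≫ σ₁, inferInstance, C₂, x₂, Finset.univ.sup k + k', h₁.comp h₂ rfl, rfl, hx₂cl, ?_⟩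
  rw [RatFn.functionFieldMap_comp, RingHom.comp_apply]
  -- the presentation at `x₁` for the transversal coordinate `e`
  have hγ' : ∀ l, IsUnit ((![(σ₁.stalkMap (σ₂ x₂)).hom γ₀ * Ω ^ k', 1] : Fin 2 → X₁.presheaf.stalk (σ₂ x₂)) l) := by
    intro l; fin_cases l
    · exact (hγ₀.map _).mul (hΩ.pow _)
    · exact isUnit_one
  have hs' : ∀ l, (![s₁, 0] : Fin 2 → X₁.presheaf.stalk (σ₂ x₂)) l ∈ stalkIdeal (vanishingIdeal C₁) (σ₂ x₂) := by
    intro l; fin_cases l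
    · exact hs₁
    · exact Ideal.zero_mem _
  have hkn' : ∀ l, (![k', 1] : Fin 2 → ℕ) l ≤ k' := by
    intro l; fin_cases l
    · exact le_rfl
    · exact hk'
  have hsum : ∑ l : Fin 2, (![k', 1] : Fin 2 → ℕ) l * (![1, N' * p] : Fin 2 → ℕ) l = k' + N' * p := by
    simp [Fin.sum_univ_two]
  by_cases hpk : p ∣ k'
  · -- uncharged second landing, decided by the residue of `γ₀`
    have hres : ∀ c₁ : X₀.presheaf.stalk (σ₁ (σ₂ x₂)), γ₀ - c₁ ^ p ∉ maximalIdeal _ := hgood.resolve_left (not_not.mpr hpk)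
    obtain ⟨k₂, hk₂⟩ := hpk
    have hPle : stalkIdeal (vanishingIdeal C₁) (σ₂ x₂) ≤ maximalIdeal _ := le_sup_left.trans he.le
    refine cleanPermissibleAt_of_pointChain_uncharged_of_residue h₂ hX₁reg hC₁reg hx₁C hdim₁ p (RatFn.functionFieldMap σ₁ G) cc' hcc'
      e (Ω ^ (N' * p)) he (hΩ.pow _) _ _ hγ' hs' ![k', 1] ![1, N' * p] hkn' (by rw [hsum, hk₂]; exact ⟨k₂ + N', by ring⟩)
      (fun c' => ?_) hX₁
    have hrew : Ω ^ (N' * p) * ∏ l : Fin 2, (![(σ₁.stalkMap (σ₂ x₂)).hom γ₀ * Ω ^ k', 1] : Fin 2 → _) l ^ (![1, N' * p] : Fin 2 → ℕ) l =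
        (σ₁.stalkMap (σ₂ x₂)).hom γ₀ * (Ω ^ (N' + k₂)) ^ p := by
      simp only [Fin.prod_univ_two, Matrix.cons_val_zero, Matrix.cons_val_one, pow_one, one_pow, mul_one]
      rw [hk₂]; ring
    rw [hrew]
    exact not_mem_of_residue_not_pow (σ₁.stalkMap (σ₂ x₂)).hom hPle hsurj p hres (hΩ.pow _) c'
  · -- charged second landing
    refine cleanPermissibleAt_of_pointChain_chargedLanding_family h₂ hX₁reg hC₁reg hx₁C hdim₁ p (RatFn.functionFieldMap σ₁ G) cc' hcc'
      e (Ω ^ (N' * p)) he (hΩ.pow _) _ _ hγ' hs' ![k', 1] ![1, N' * p] hkn' ?_ hX₁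
    rw [hsum]
    intro hdiv
    exact hpk ((Nat.dvd_add_left (dvd_mul_left p N')).mp hdiv)

end Summit.ResolutionOfSingularities.ResolutionOfSingularities.Theorems.RadicialJung.CleanModels

end
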